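import Literature.NumberTheory.LFunctions.StarkNoQuadraticSubfieldGlue
import Mathlib.FieldTheory.Normal.Closure
import Mathlib.FieldTheory.Galois.Basic
import Mathlib.Algebra.Group.End
import Mathlib.GroupTheory.Perm.Fin
import HarnessLib

/-!
# The embedded `S_n`-closure of a degree-`n` field, and bookkeeping in `Perm (Fin n)`

Topic `Summits/QuantumAdvantage/QuantumAdvantage/Theorems`, cell B2b-1 (linnik-cubic), PART A (gen 8);
helper toward the crux `DegreeOnePrimesEscape` (stmt-QuantumAdvantage-11543) of route
`LinnikCubicClassGroups`.  HONEST FRAMING: the value of this file is a THEOREM (kernel-checked field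
theory and finite combinatorics) — NOT summit progress.

General-degree version of `…QuarticS4Closure.lean`.  An "`S_n`-field" is a number field `K` of degree
`n` all of whose Galois splitting fields have degree `≥ n!` (the Galois closure always has degree
`≤ n!`).  For such `K`, the normal closure `N` of `K` in `ℚ̄` is a Galois number field of degree `n!`;
`G = Gal(N/ℚ)` acts faithfully on the `n` embeddings `K → N`, giving `ψ : G ≃* Perm (Fin n)` under
which `Gal(N/K')`, `K' = f₀(K)`, is the stabiliser of `0`; and `|d_N| ≤ |d_K|^{n!}`
(`symmetricClosure`).  Bookkeeping: transport of conjugation counts along `ψ`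
(`natCard_conj_mem_eq_card_filter_perm`, `natCard_subgroup_eq_card_filter_perm`) and the fixed-point
count `#{q ∈ S_n : P(q 0)} = #{q : q 0 = 0} · #{i : P i}` (`card_filter_perm_apply_zero`).
-/

noncomputable section

open scoped NumberField
open Literature.NumberTheory.LFunctions Literature.NumberTheory.LFunctions.NumberField

namespace Summit.QuantumAdvantage.QuantumAdvantage.Theorems.DegreeOnePrimesEscape

/-! ### Bookkeeping in `Perm (Fin n)` -/

section Transport

variable {n : ℕ} {G : Type*} [Group G] (ψ : G ≃* Equiv.Perm (Fin n))

/-- Transport of a conjugation count along `ψ : G ≃* S_n`: if `H = ψ⁻¹{q : P q}` then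
`#{g ∈ G : g x g⁻¹ ∈ H} = #{q ∈ S_n : P (q ψ(x) q⁻¹)}`. -/
theorem natCard_conj_mem_eq_card_filter_perm (H : Subgroup G) (P : Equiv.Perm (Fin n) → Prop)
    [DecidablePred P] (hH : ∀ g, g ∈ H ↔ P (ψ g)) (x : G) :
    Nat.card {g : G // g * x * g⁻¹ ∈ H} =
      (Finset.univ.filter fun q : Equiv.Perm (Fin n) => P (q * ψ x * q⁻¹)).card := by
  have e : {g : G // g * x * g⁻¹ ∈ H} ≃ {q : Equiv.Perm (Fin n) // P (q * ψ x * q⁻¹)} :=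
    { toFun := fun g => ⟨ψ g.1, by
        have h := (hH _).mp g.2
        rwa [map_mul, map_mul, map_inv] at h⟩
      invFun := fun q => ⟨ψ.symm q.1, by
        rw [hH, map_mul, map_mul, map_inv, MulEquiv.apply_symm_apply]; exact q.2⟩
      left_inv := fun g => Subtype.ext (ψ.symm_apply_apply g.1)
      right_inv := fun q => Subtype.ext (ψ.apply_symm_apply q.1) }
  rw [Nat.card_congr e, Nat.card_eq_fintype_card, Fintype.card_subtype]

/-- Transport of the order of a subgroup: if `H = ψ⁻¹{q : P q}` then `|H| = #{q ∈ S_n : P q}`. -/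
theorem natCard_subgroup_eq_card_filter_perm (H : Subgroup G) (P : Equiv.Perm (Fin n) → Prop)
    [DecidablePred P] (hH : ∀ g, g ∈ H ↔ P (ψ g)) :
    Nat.card H = (Finset.univ.filter fun q : Equiv.Perm (Fin n) => P q).card := by
  have e : H ≃ {q : Equiv.Perm (Fin n) // P q} :=
    { toFun := fun g => ⟨ψ g.1, (hH _).mp g.2⟩
      invFun := fun q => ⟨ψ.symm q.1, by rw [hH, MulEquiv.apply_symm_apply]; exact q.2⟩
      left_inv := fun g => Subtype.ext (ψ.symm_apply_apply g.1)
      right_inv := fun q => Subtype.ext (ψ.apply_symm_apply q.1) }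
  rw [Nat.card_congr e, Nat.card_eq_fintype_card, Fintype.card_subtype]

end Transport

/-- **Fixed-point bookkeeping in `S_n`**: `#{q ∈ S_n : P (q 0)} = #{q : q 0 = 0} · #{i : P i}` (the
fibres of `q ↦ q 0` all have the size of the stabiliser of `0`). -/
theorem card_filter_perm_apply_zero {n : ℕ} [NeZero n] (P : Fin n → Prop) [DecidablePred P] :
    (Finset.univ.filter fun q : Equiv.Perm (Fin n) => P (q 0)).card =
      (Finset.univ.filter fun q : Equiv.Perm (Fin n) => q 0 = 0).card *
        (Finset.univ.filter P).card := by
  classical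
  rw [Finset.card_eq_sum_card_fiberwise (f := fun q : Equiv.Perm (Fin n) => q 0)
    (t := Finset.univ.filter P) (fun q hq => by
      have hq' := Finset.mem_filter.mp (Finset.mem_coe.mp hq)
      exact Finset.mem_coe.mpr (Finset.mem_filter.mpr ⟨Finset.mem_univ _, hq'.2⟩))]
  have hfib : ∀ i ∈ Finset.univ.filter P,
      ((Finset.univ.filter fun q : Equiv.Perm (Fin n) => P (q 0)).filter
        (fun q : Equiv.Perm (Fin n) => q 0 = i)).card =
      (Finset.univ.filter fun q : Equiv.Perm (Fin n) => q 0 = 0).card := by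
    intro i hi
    rw [Finset.mem_filter] at hi
    refine Finset.card_bij (fun q _ => Equiv.swap 0 i * q) ?_ ?_ ?_
    · intro q hq
      rw [Finset.mem_filter, Finset.mem_filter] at hq
      rw [Finset.mem_filter]
      refine ⟨Finset.mem_univ _, ?_⟩
      rw [Equiv.Perm.mul_apply, hq.2, Equiv.swap_apply_right]
    · intro q₁ _ q₂ _ h
      exact mul_left_cancel h
    · intro q hq
      rw [Finset.mem_filter] at hq
      refine ⟨Equiv.swap 0 i * q, ?_, ?_⟩
      · rw [Finset.mem_filter, Finset.mem_filter]
        have h0 : (Equiv.swap 0 i * q) 0 = i := by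
          rw [Equiv.Perm.mul_apply, hq.2, Equiv.swap_apply_left]
        exact ⟨⟨Finset.mem_univ _, by rw [h0]; exact hi.2⟩, h0⟩
      · rw [← mul_assoc, Equiv.swap_mul_self, one_mul]
  rw [Finset.sum_congr rfl hfib, Finset.sum_const, smul_eq_mul, mul_comm]

/-- **The conjugation count of a point stabiliser is a fixed-point count**:
`#{q ∈ S_n : (q τ q⁻¹)(0) = 0} = #{q : q 0 = 0} · #Fix(τ)`. -/
theorem card_filter_conj_apply_zero {n : ℕ} [NeZero n] (τ : Equiv.Perm (Fin n)) :
    (Finset.univ.filter fun q : Equiv.Perm (Fin n) => (q * τ * q⁻¹) 0 = 0).card =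
      (Finset.univ.filter fun q : Equiv.Perm (Fin n) => q 0 = 0).card *
        (Finset.univ.filter fun i : Fin n => τ i = i).card := by
  classical
  rw [← card_filter_perm_apply_zero (fun i => τ i = i)]
  -- `q ↦ q⁻¹` matches the two conditions
  refine Finset.card_bij (fun q _ => q⁻¹) ?_ ?_ ?_
  · intro q hq
    rw [Finset.mem_filter] at hq ⊢
    refine ⟨Finset.mem_univ _, ?_⟩
    have h := hq.2
    rw [Equiv.Perm.mul_apply, Equiv.Perm.mul_apply] at h
    exact Equiv.Perm.eq_inv_iff_eq.mpr h
  · intro q₁ _ q₂ _ h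
    exact inv_injective h
  · intro q hq
    rw [Finset.mem_filter] at hq
    refine ⟨q⁻¹, ?_, inv_inv q⟩
    rw [Finset.mem_filter]
    refine ⟨Finset.mem_univ _, ?_⟩
    rw [Equiv.Perm.mul_apply, Equiv.Perm.mul_apply, inv_inv, hq.2, Equiv.Perm.inv_eq_iff_eq]

/-! ### The `S_n`-closure -/

/-- Transport of `Algebra.IsAlgebraic` along an equality of algebra structures. -/
private theorem isAlgebraic_of_algebra_eq_sym {F L : Type*} [Field F] [Field L] {A : Algebra F L}
    (B : Algebra F L) (h : A = B) (hA : @Algebra.IsAlgebraic F L _ _ A) :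
    @Algebra.IsAlgebraic F L _ _ B := by
  subst h; exact hA

/-- The normal closure of a finite extension `K/F` of a perfect field inside a normal `L/F` is
Galois over `F`. -/
private theorem isGalois_normalClosure_of_perfectField_sym (F K L : Type*) [Field F] [Field K]
    [Field L] [Algebra F K] [Algebra F L] [FiniteDimensional F K] [Normal F L] [PerfectField F] :
    IsGalois F (IntermediateField.normalClosure F K L) where

/-- **Abstract step.** Let `K` be a number field of degree `n` all of whose Galois splitting fields have
degree `≥ n!`, and `M/ℚ` a finite Galois extension with `#Gal(M/ℚ) ≤ n!` in which the embedded copies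
of `K` separate the Galois group, with one embedding `f₀ : K → M`.  Then `M` is a Galois number field of
degree `n!`, `Gal(M/ℚ) ≃ S_n` with `Gal(M/f₀K)` the stabiliser of a point, and `|d_M| ≤ |d_K|^{n!}`. -/
private theorem symmetricClosure_of_inputs (n : ℕ) [NeZero n] (K : Type) [Field K] [NumberField K]
    (hK : Module.finrank ℚ K = n)
    (hSn : ∀ (M' : Type) [Field M'] [NumberField M'] [IsGalois ℚ M'],
      (K →ₐ[ℚ] M') → n.factorial ≤ Module.finrank ℚ M')
    (M : Type) [Field M] {alg : Algebra ℚ M} (hfin : FiniteDimensional ℚ M) (hG : IsGalois ℚ M)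
    (hcard : Nat.card (M ≃ₐ[ℚ] M) ≤ n.factorial)
    (hsep : ∀ s : M ≃ₐ[ℚ] M, s ≠ 1 → ∃ f : K →ₐ[ℚ] M, s ∉ f.fieldRange.fixingSubgroup)
    (f₀ : K →ₐ[ℚ] M) :
    ∃ (N : Type) (_ : Field N) (_ : NumberField N), IsGalois ℚ N ∧
      Module.finrank ℚ N = n.factorial ∧
      ∃ (K' : IntermediateField ℚ N) (_ : K ≃ₐ[ℚ] K') (ψ : (N ≃ₐ[ℚ] N) ≃* Equiv.Perm (Fin n)),
        (∀ g : N ≃ₐ[ℚ] N, g ∈ K'.fixingSubgroup ↔ ψ g 0 = 0) ∧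
        (NumberField.discr N).natAbs ≤ (NumberField.discr K).natAbs ^ n.factorial := by
  classical
  have hcz : CharZero M := charZero_of_injective_algebraMap (algebraMap ℚ M).injective
  obtain rfl : alg = DivisionRing.toRatAlgebra := Subsingleton.elim _ _
  haveI hNF : NumberField M := @NumberField.mk M _ hcz hfin
  -- the degree is `n!`
  have hGal : Nat.card (M ≃ₐ[ℚ] M) = Module.finrank ℚ M := IsGalois.card_aut_eq_finrank ℚ M
  have hdeg : Module.finrank ℚ M = n.factorial := le_antisymm (hGal ▸ hcard) (hSn M f₀)
  have hGn : Nat.card (M ≃ₐ[ℚ] M) = n.factorial := hGal.trans hdeg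
  -- the action of `G` on the embeddings `K → M`
  let ψ₀ : (M ≃ₐ[ℚ] M) →* Equiv.Perm (K →ₐ[ℚ] M) :=
    { toFun := fun s => ⟨fun f => s.toAlgHom.comp f, fun f => s.symm.toAlgHom.comp f,
        fun f => by ext x; simp, fun f => by ext x; simp⟩
      map_one' := by ext f x; rfl
      map_mul' := fun s t => by ext f x; rfl }
  have hψ₀ : ∀ (s : M ≃ₐ[ℚ] M) (f : K →ₐ[ℚ] M) (x : K), ψ₀ s f x = s (f x) := fun s f x => rfl
  have hinj : Function.Injective ψ₀ := by
    intro s t hst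
    by_contra hne
    have hne1 : t⁻¹ * s ≠ 1 := fun h1 => hne (by
      have h2 := congrArg (t * ·) h1
      simpa using h2)
    obtain ⟨f, hf⟩ := hsep _ hne1
    apply hf
    rw [IntermediateField.mem_fixingSubgroup_iff]
    rintro _ ⟨x, rfl⟩
    have hx : s (f x) = t (f x) := by
      rw [← hψ₀ s f x, ← hψ₀ t f x, hst]
    show (t⁻¹ * s) (f x) = f x
    rw [AlgEquiv.mul_apply, hx, AlgEquiv.aut_inv, AlgEquiv.symm_apply_apply]
  -- there are exactly `n` embeddings and `ψ₀` is bijective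
  have hEmb_le : Fintype.card (K →ₐ[ℚ] M) ≤ n := by
    rw [← Nat.card_eq_fintype_card, ← hK]; exact card_algHom_le_finrank ℚ K M
  have hEmb_pos : 0 < Fintype.card (K →ₐ[ℚ] M) := Fintype.card_pos_iff.mpr ⟨f₀⟩
  have hPerm : Nat.card (M ≃ₐ[ℚ] M) ≤ Nat.card (Equiv.Perm (K →ₐ[ℚ] M)) :=
    Nat.card_le_card_of_injective ψ₀ hinj
  rw [hGn, Nat.card_eq_fintype_card, Fintype.card_perm] at hPerm
  have hEmb : Fintype.card (K →ₐ[ℚ] M) = n := by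
    by_contra hne
    have hlt : Fintype.card (K →ₐ[ℚ] M) < n := lt_of_le_of_ne hEmb_le hne
    have := (Nat.factorial_lt hEmb_pos).mpr hlt
    omega
  have hbij : Function.Bijective ψ₀ := hinj.bijective_of_nat_card_le (by
    rw [hGn, Nat.card_eq_fintype_card, Fintype.card_perm, hEmb])
  -- number the embeddings with `f₀ ↦ 0`
  let e₁ : (K →ₐ[ℚ] M) ≃ Fin n := Fintype.equivFinOfCardEq hEmb
  let e : (K →ₐ[ℚ] M) ≃ Fin n := e₁.trans (Equiv.swap (e₁ f₀) 0)
  have he : e f₀ = 0 := by simp [e, Equiv.swap_apply_left]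
  let ψ : (M ≃ₐ[ℚ] M) ≃* Equiv.Perm (Fin n) := (MulEquiv.ofBijective ψ₀ hbij).trans e.permCongrHom
  have hstab : ∀ g : M ≃ₐ[ℚ] M, g ∈ f₀.fieldRange.fixingSubgroup ↔ ψ g 0 = 0 := by
    intro g
    have h1 : ψ g 0 = e (ψ₀ g (e.symm 0)) := rfl
    have h2 : e.symm 0 = f₀ := by rw [← he, Equiv.symm_apply_apply]
    rw [h1, h2, ← he, e.apply_eq_iff_eq, IntermediateField.mem_fixingSubgroup_iff]
    constructor
    · intro h
      ext x
      rw [hψ₀]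
      exact h _ ⟨x, rfl⟩
    · intro h
      rintro _ ⟨x, rfl⟩
      have h3 : ψ₀ g f₀ x = f₀ x := congrArg (fun φ : K →ₐ[ℚ] M => φ x) h
      rw [hψ₀] at h3
      exact h3
  -- the discriminant bound
  have hdisc : (NumberField.discr M).natAbs ≤ (NumberField.discr K).natAbs ^ n.factorial :=
    hdeg ▸ natAbs_discr_le_pow_of_separating K M hsep
  exact ⟨M, inferInstance, hNF, hG, hdeg, f₀.fieldRange, f₀.equivFieldRange, ψ, hstab, hdisc⟩

/-- **The embedded `S_n`-closure of an `S_n`-field.** Let `K` be a number field of degree `n` such that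
every Galois number field into which `K` embeds has degree `≥ n!`.  Then there is a Galois number field
`N` of degree `n!` containing a copy `K'` of `K`, with an isomorphism `ψ : Gal(N/ℚ) ≃* Perm (Fin n)` under
which `Gal(N/K')` is the stabiliser of `0`, and `|d_N| ≤ |d_K|^{n!}`. -/
theorem symmetricClosure (n : ℕ) [NeZero n] (K : Type) [Field K] [NumberField K]
    (hK : Module.finrank ℚ K = n)
    (hSn : ∀ (M : Type) [Field M] [NumberField M] [IsGalois ℚ M],
      (K →ₐ[ℚ] M) → n.factorial ≤ Module.finrank ℚ M) :
    ∃ (N : Type) (_ : Field N) (_ : NumberField N), IsGalois ℚ N ∧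
      Module.finrank ℚ N = n.factorial ∧
      ∃ (K' : IntermediateField ℚ N) (_ : K ≃ₐ[ℚ] K') (ψ : (N ≃ₐ[ℚ] N) ≃* Equiv.Perm (Fin n)),
        (∀ g : N ≃ₐ[ℚ] N, g ∈ K'.fixingSubgroup ↔ ψ g 0 = 0) ∧
        (NumberField.discr N).natAbs ≤ (NumberField.discr K).natAbs ^ n.factorial := by
  haveI : IsAlgClosure ℚ (AlgebraicClosure ℚ) :=
    ⟨inferInstance, isAlgebraic_of_algebra_eq_sym _ (Subsingleton.elim _ _)
      (AlgebraicClosure.isAlgebraic ℚ)⟩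
  have hcard := card_algEquiv_normalClosure_le_factorial ℚ K (AlgebraicClosure ℚ)
  rw [← Nat.card_eq_fintype_card, hK] at hcard
  exact symmetricClosure_of_inputs n K hK hSn (IntermediateField.normalClosure ℚ K (AlgebraicClosure ℚ))
    (normalClosure.is_finiteDimensional ℚ K (AlgebraicClosure ℚ))
    (isGalois_normalClosure_of_perfectField_sym ℚ K (AlgebraicClosure ℚ)) hcard
    (fun _ hs => exists_not_mem_fixingSubgroup_fieldRange ℚ K (AlgebraicClosure ℚ) hs)
    ((normalClosure.algHomEquiv ℚ K (AlgebraicClosure ℚ)).symm IsAlgClosed.lift)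

end Summit.QuantumAdvantage.QuantumAdvantage.Theorems.DegreeOnePrimesEscape

end
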